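import Summits.CriticalPhenomena.PercolationContinuityZ3.Theorems.PercNearOneGluingNoHeavyLowerTailKnQuestion8CoefficientwiseCoreClassSeriesAdj
import HarnessLib

/-!
# The one-sided root inequality for bundles, I: private runs at the root (cluster bookkeeping, reindexing, one-bit Chebyshev)

Support file (`--supports stmt-CriticalPhenomena-4575`, closed), prover `prim-cplus-coupling` (gen 33).  No definitions, no notations, no named facts,
no sorries; standard axioms.  Memo `prim-cplus-coupling/A5-COUPLING-gen33.md` §1.  Consumed by `…CoreClassOneSidedRootCore` (the induction) and
`…CoreClassOneSidedRootBundle` (THEOREM OSR-Θ: the one-sided root inequality `OSR(E₁; c, a)` of `…CoreClassSeriesC6` / `…CoreClassSeriesMain` holds for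
every edge set `E₁` all of whose vertices other than `c, a` lie on at most two edges — every bundle `Θ(k₁,…,k_r)` of `c–a` threads, with ears and
pendant paths at `c` and anything at `a`).

The proof of THEOREM OSR-Θ ties the LEADING RUN of an arm at the root `c` (its maximal monochromatic initial segment) and averages over the colour of
the run (one-bit Chebyshev); this file supplies the deterministic pieces:
* `Coefficientwise.openCluster_union_privateBlob` — LEMMA A: if the edges `Run` live on `W ∪ {c}`, join all of `W` to `c`, and no edge of `ω` meets
  `W`, then `C_c(ω ∪ Run) = C_c(ω) ∪ W`;
* `Coefficientwise.openCluster_union_stopper` — LEMMA B: for an edge `f = {p, w}` with `p ≠ c, w` met by no edge of `ω`,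
  `C_c(ω ∪ {f}) = C_c(ω) ∪ {p | w ∈ C_c(ω)}`;
* `Coefficientwise.sum_powerset_inter_eq` — `Σ_{ω ⊆ E : ω ∩ D = T} g(ω) = Σ_{ω° ⊆ E ∖ D} g(ω° ∪ T)` (`T ⊆ D ⊆ E`);
* `Coefficientwise.oneBit_chebyshev` — `f₁g₁ + f₂g₂ ≥ 2·((f₁+f₂)/2)((g₁+g₂)/2)` when `f₂ ≤ f₁`, `g₂ ≤ g₁`.
[cite: KozmaNitzan2024, Questions 8–9 (§5.5 p. 36) (context: the Question-8 pocket covariance programme)]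
-/

namespace Summit.CriticalPhenomena.PercolationContinuityZ3.Theorems

open Finset Literature.Probability.Percolation

namespace Coefficientwise

variable {ι V : Type*}

open Classical in
/-- **LEMMA A (a private blob at the root).**  If every edge of `Run` has its ends in `W ∪ {c}`, every vertex of `W` is joined to `c` by `Run`, and no
edge of `ω` meets `W`, then `C_c(ω ∪ Run) = C_c(ω) ∪ W`. [cite: KozmaNitzan2024, §5.5 (context only; folklore)] -/
theorem openCluster_union_privateBlob (ends : ι → Sym2 V) (ω Run : Finset ι) (W : Set V) (c : V)
    (hRun : ∀ i ∈ Run, ∀ x, x ∈ ends i → x ∈ W ∨ x = c)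
    (hW : ∀ x ∈ W, x ∈ openCluster (ends '' (↑Run : Set ι)) c)
    (hpriv : ∀ i ∈ ω, ∀ x, x ∈ ends i → x ∉ W) :
    openCluster (ends '' (↑(ω ∪ Run) : Set ι)) c = openCluster (ends '' (↑ω : Set ι)) c ∪ W := by
  apply Set.Subset.antisymm
  · refine openCluster_subset_of_closed ends (ω ∪ Run) c (S := openCluster (ends '' (↑ω : Set ι)) c ∪ W)
      (Or.inl (mem_openCluster_self _ _)) ?_
    intro i hi p q he hp
    rcases Finset.mem_union.mp hi with hi | hi
    · rcases hp with hp | hp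
      · exact Or.inl (mem_openCluster_of_edge ends hi he hp)
      · exact absurd hp (hpriv i hi p (by rw [he]; exact Sym2.mem_mk_left p q))
    · rcases hRun i hi q (by rw [he]; exact Sym2.mem_mk_right p q) with hq | hq
      · exact Or.inr hq
      · rw [hq]; exact Or.inl (mem_openCluster_self _ _)
  · intro y hy
    rcases hy with hy | hy
    · exact openCluster_image_mono ends Finset.subset_union_left c hy
    · exact openCluster_image_mono ends Finset.subset_union_right c (hW y hy)

open Classical in
/-- **LEMMA B (a stopper edge).**  Let `f` be an edge with ends `{p, w}`, `p ≠ c`, `p ≠ w`, and suppose no edge of `ω` contains `p`.  Then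
`C_c(ω ∪ {f}) = C_c(ω) ∪ {p | w ∈ C_c(ω)}`. [cite: KozmaNitzan2024, §5.5 (context only; folklore)] -/
theorem openCluster_union_stopper (ends : ι → Sym2 V) (ω : Finset ι) (f : ι) (p w c : V)
    (hf : ends f = s(p, w)) (hpc : p ≠ c) (hpw : p ≠ w) (hpriv : ∀ i ∈ ω, p ∉ ends i) :
    openCluster (ends '' (↑(ω ∪ {f}) : Set ι)) c =
      openCluster (ends '' (↑ω : Set ι)) c ∪ {y | y = p ∧ w ∈ openCluster (ends '' (↑ω : Set ι)) c} := by
  have hpω : p ∉ openCluster (ends '' (↑ω : Set ι)) c := not_mem_openCluster_of_no_edge_at ends ω (Ne.symm hpc) hpriv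
  apply Set.Subset.antisymm
  · refine openCluster_subset_of_closed ends (ω ∪ {f}) c
      (S := openCluster (ends '' (↑ω : Set ι)) c ∪ {y | y = p ∧ w ∈ openCluster (ends '' (↑ω : Set ι)) c})
      (Or.inl (mem_openCluster_self _ _)) ?_
    intro i hi u q he hu
    rcases Finset.mem_union.mp hi with hi | hi
    · rcases hu with hu | ⟨hu, _⟩
      · exact Or.inl (mem_openCluster_of_edge ends hi he hu)
      · exact absurd (by rw [he, hu]; exact Sym2.mem_mk_left p q) (hpriv i hi)
    · rw [Finset.mem_singleton] at hi
      have huq : s(u, q) = s(p, w) := by rw [← he, hi, hf]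
      rcases Sym2.eq_iff.mp huq with ⟨hu', hq'⟩ | ⟨hu', hq'⟩
      · -- `u = p`, `q = w`
        rcases hu with hu | ⟨_, hw⟩
        · rw [hu'] at hu; exact absurd hu hpω
        · rw [hq']; exact Or.inl hw
      · -- `u = w`, `q = p`
        rcases hu with hu | ⟨hu2, _⟩
        · rw [hu'] at hu; exact Or.inr ⟨hq', hu⟩
        · exact absurd (hu2.symm.trans hu') hpw
  · intro y hy
    rcases hy with hy | ⟨hyp, hw⟩
    · exact openCluster_image_mono ends Finset.subset_union_left c hy
    · rw [hyp]
      have hw' : w ∈ openCluster (ends '' (↑(ω ∪ {f}) : Set ι)) c := openCluster_image_mono ends Finset.subset_union_left c hw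
      exact mem_openCluster_of_edge ends (Finset.mem_union_right _ (Finset.mem_singleton_self f)) (hf.trans Sym2.eq_swap) hw'

open Classical in
/-- Reindexing a powerset sum along a prescribed intersection: for `T ⊆ D ⊆ E`, `Σ_{ω ⊆ E : ω ∩ D = T} g(ω) = Σ_{ω° ⊆ E ∖ D} g(ω° ∪ T)`.
[cite: KozmaNitzan2024, §5.5 (context only; bookkeeping)] -/
theorem sum_powerset_inter_eq (E D T : Finset ι) (hD : D ⊆ E) (hT : T ⊆ D) (g : Finset ι → ℝ) :
    ∑ ω ∈ E.powerset.filter (fun ω => ω ∩ D = T), g ω = ∑ ω ∈ (E \ D).powerset, g (ω ∪ T) := by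
  have key : ∀ ω, ω ∩ D = T → ω \ D ∪ T = ω := by
    intro ω hω
    ext i
    simp only [Finset.mem_union, Finset.mem_sdiff]
    constructor
    · rintro (⟨hi, _⟩ | hi)
      · exact hi
      · have : i ∈ ω ∩ D := by rw [hω]; exact hi
        exact (Finset.mem_inter.mp this).1
    · intro hi
      by_cases hiD : i ∈ D
      · right; rw [← hω]; exact Finset.mem_inter.mpr ⟨hi, hiD⟩
      · exact Or.inl ⟨hi, hiD⟩
  refine Finset.sum_bij' (fun ω _ => ω \ D) (fun ω _ => ω ∪ T) ?_ ?_ ?_ ?_ ?_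
  · intro ω hω
    rw [Finset.mem_filter, Finset.mem_powerset] at hω
    exact Finset.mem_powerset.mpr (Finset.sdiff_subset_sdiff hω.1 le_rfl)
  · intro ω hω
    rw [Finset.mem_powerset] at hω
    rw [Finset.mem_filter, Finset.mem_powerset]
    refine ⟨Finset.union_subset (hω.trans Finset.sdiff_subset) (hT.trans hD), ?_⟩
    ext i
    simp only [Finset.mem_inter, Finset.mem_union]
    constructor
    · rintro ⟨hi | hi, hiD⟩
      · exact absurd hiD (Finset.mem_sdiff.mp (hω hi)).2
      · exact hi
    · intro hi; exact ⟨Or.inr hi, hT hi⟩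
  · intro ω hω
    rw [Finset.mem_filter] at hω
    exact key ω hω.2
  · intro ω hω
    rw [Finset.mem_powerset] at hω
    ext i
    simp only [Finset.mem_sdiff, Finset.mem_union]
    constructor
    · rintro ⟨hi | hi, hiD⟩
      · exact hi
      · exact absurd (hT hi) hiD
    · intro hi; exact ⟨Or.inl hi, (Finset.mem_sdiff.mp (hω hi)).2⟩
  · intro ω hω
    rw [Finset.mem_filter] at hω
    rw [key ω hω.2]

/-- One-bit Chebyshev: if `f₂ ≤ f₁` and `g₂ ≤ g₁` then `f₁g₁ + f₂g₂ ≥ 2·((f₁+f₂)/2)·((g₁+g₂)/2)`. [cite: KozmaNitzan2024, §5.5 (context only; Chebyshev)] -/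
theorem oneBit_chebyshev (f₁ f₂ g₁ g₂ : ℝ) (hf : f₂ ≤ f₁) (hg : g₂ ≤ g₁) :
    2 * (((f₁ + f₂) / 2) * ((g₁ + g₂) / 2)) ≤ f₁ * g₁ + f₂ * g₂ := by
  nlinarith [mul_nonneg (sub_nonneg.mpr hf) (sub_nonneg.mpr hg)]

end Coefficientwise

end Summit.CriticalPhenomena.PercolationContinuityZ3.Theorems
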